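import Summits.QuantumFields.YangMills.Theorems.FluctuationComparisonRegPrIntLS2BetaCovWalkSumStokes
import Literature.MathematicalPhysics.QuantumFieldTheory.Balaban1983to89.BlockAveragingEMLProp2
import HarnessLib

/-!
# S2β · (CURL-AVG, FILE B1) TRANSPORT LETTERS FOR THE COARSE LINEARISED CURL: the coarse plaquette word and the fine `a × b` rectangle word EXPANDED into four transported terms,
# and the three transport mismatches around `∂p′` bounded by the (0.4) loop identities — per comb index the coarse-transported line terms ARE the transported `L × L` square up to `48·α·L·M`

Cell `ym3-torus` (YM ladder rung R3 = continuum `SU(2)` Yang–Mills on the three-torus at fixed lattice data — a RUNG: NOT d = 4, NOT infinite volume, NOT a mass gap,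
NOT Clay).  Width seat `ym3-torus-px13` (gen 26); crux `stmt-QuantumFields-20520`, LINE g18-1 S2β, pairing lane, AVG₂♭-ax_q ∕ `hLoc` ⟸ SUP chain ⟸ (ST) ⟸ (SCT) + lift recursion
(px17 g22 UV3-NODE §94.5); per-step brick (CURL-AVG) «the one-step (0.4) average transports linearised covariant curls by DILUTED Stokes» (px16 g22 lane GO 16:56:35Z):
FILE A ✓p829604 `…CovWalkSumStokes` (linearised lattice Stokes for `covWalkSum`), THIS FILE B1 (transport letters), FILE B2 `…CoarseCurlOfLinAvg` (the knit for `Q₁^{R₀}`).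
`--kind proof --supports stmt-QuantumFields-20520 --as helper`, count-neutral, DEFINITION-FREE; generic `P : Params`, `SU(N)`, levels `j → j+1`, matrix-valued bond fields `Y`;
the record's average `Ū = avgFun expMeanLogSU = corr · axialAvg`.

NOTATION (written out in every signature).  Coarse plaquette `p′ = (y; μ, ν)` read as the word `[μ⁺, ν⁺, μ̄, ν̄]` from `y`, bonds `c₁ = ⟨y,μ⟩, c₂ = ⟨y+e_μ,ν⟩, c₃ = ⟨y+e_ν,μ⟩, c₄ = ⟨y,ν⟩`;
`Y_V(γ)[Z] := covWalkSum V Z γ` (lit `BlockAveragingEMLLinearisedBackground`, [Balaban1985Averaging] (58)); comb index `i = (r, σ, σ′)`, staircase `s = Γ^σ(n_r)`, comb point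
`x_i = walkEnd (emb y) s`, `A = U₀(walk (emb y) s)`, `A₂, A₃, A₂₃` the same from `emb(y+e_μ)`, `emb(y+e_ν)`, `emb(y+e_μ+e_ν)`; line holonomies `B₁ = U₀(μ^L @ x_i)`, `B₂ = U₀(ν^L @ x^{(2)}_i)`,
`B₃ = U₀(μ^L @ x^{(3)}_i)`, `B₄ = U₀(ν^L @ x_i)`; loop variables `W_k = loopHol U₀ c_k (r,σ,σ)`, `a_k = axialAvg U₀ c_k`, `κ_k = corr ℰ U₀ c_k`, `Ū(c_k) = κ_k a_k`.

WHAT IS PROVED (sorry-free).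
* §3 `covWalkSum_walk_plaq_eq` — `Y_V(∂p′)[Z] = Z(c₁) + V₁Z(c₂)V₁⋆ − T₃Z(c₃)T₃⋆ − T₄Z(c₄)T₄⋆`, `T₃ = V₁V₂V₃⁻¹`, `T₄ = V₁V₂V₃⁻¹V₄⁻¹` (any level, any `V`, `Z`); `shift_shift_unshift`.
* §4 `covWalkSum_walk_rect_eq` — `Y_{U₀}(walk x (μ^a ν^b μ̄^a ν̄^b)) = S₁ + B₁S₂B₁⋆ − (B₁B₂B₃⁻¹)S₃(..)⋆ − (B₁B₂B₃⁻¹B₄⁻¹)S₄(..)⋆` (four straight-line sums; lit ✓`covWalkSum_walk_wordRev`); `walkEnd_replicate_comm`.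
* §5 `norm_conj_sub_conj_le` (`‖T′ST′⋆ − TST⋆‖ ≤ 2·dist1(T⁻¹T′)·‖S‖`), `dist1_inv_conj`; `dist1_mismatch₂_le` ∕ `₃` ∕ `₄` — under `B₁ = A⁻¹W₁a₁A₂`, `B₂ = A₂⁻¹W₂a₂A₂₃`, `B₃ = A₃⁻¹W₃a₃A₂₃`,
  `B₄ = A⁻¹W₄a₄A₃`: `dist1((AB₁)⁻¹(κ₁a₁A₂)) ≤ W₁+κ₁`, `dist1((AB₁B₂B₃⁻¹)⁻¹(κ₁a₁κ₂a₂(κ₃a₃)⁻¹A₃)) ≤ ΣW+Σκ`, `dist1((AB₁B₂B₃⁻¹B₄⁻¹)⁻¹(…(κ₄a₄)⁻¹A)) ≤ ΣW+Σκ` (in `dist1`; the axial transporters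
  cancel in conjugate pairs — `group` + `dist1_conj`); `holAt_line_eq_of_loopHol` (lit ✓`loopHol_eq` solved for the line: `B = A⁻¹·W·a·A′`).
* §6 ★★`norm_lineTerms_sub_conj_rect_le` — PER INDEX, with the loop guard `dist1 W ≤ α` at the four bonds (`α < δ_N`, `α ≤ 1∕6`, so `dist1 κ ≤ 2α` by lit ✓`dist1_corr_le_two_mul`) and `‖Y b‖ ≤ M`:
  **`‖[AS₁A⋆ + Ū(c₁)(A₂S₂A₂⋆)Ū(c₁)⋆ − T₃(A₃S₃A₃⋆)T₃⋆ − T₄(AS₄A⋆)T₄⋆] − A·Y_{U₀}(walk x_i (μ^L ν^L μ̄^L ν̄^L))·A⋆‖ ≤ 48·α·(L·M)`** (`2·(3 + 9 + 12)·α`, each line sum `≤ L·M`).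

HONEST.  Matrix ∕ group bookkeeping over LANDED letters (FILE A ✓p829604, lit `covWalkSum_walk_wordRev`, `loopHol_eq`, `dist1_corr_le_two_mul`); nothing of Bałaban's analysis
asserted; the knit (FILE B2), the true-derivative ∕ nonlinear editions (FILE C), (SCT), (ST), LOC ∕ `hLoc`, AVG₂♭-ax_q, GAP♯∘ (registry 3732b7df UNTOUCHED, 0∕5), the five
REGISTERED stubs, S2β, crux 20520, 19936, 19200, `YM3TorusSU2` — NOT proved; rung R3 = SU(2) YM₃ on T³ — NOT d = 4, NOT infinite volume, NOT a mass gap, NOT Clay; the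
Yang–Mills mass gap is NOT proved.  Axioms standard.

References: [Balaban1985Averaging] CMP **98** (1985) (9)–(10) p.19, (19)–(20) p.21, (58) p.27, Prop. 3 (124)–(125) p.36; [Balaban1987RG1] CMP **109** (1987) (0.3)–(0.4) pp.252–253.
-/

set_option autoImplicit false

noncomputable section

open scoped Matrix.Norms.L2Operator BigOperators
open Finset

namespace Summit.QuantumFields.YangMills.Theorems.FluctuationComparisonRegPrIntLS2BetaCoarseCurlTransports

open Literature.MathematicalPhysics.QuantumFieldTheory.Balaban1983to89
open Literature.MathematicalPhysics.QuantumFieldTheory.Balaban1983to89.T4Continuum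
open Literature.MathematicalPhysics.QuantumFieldTheory.Balaban1983to89.BlockAveraging (Idx avgFun loopHol off corr Small)
open Literature.MathematicalPhysics.QuantumFieldTheory.Balaban1983to89.ExpMeanLog (expMeanLogSU deltaSU)
open Literature.MathematicalPhysics.QuantumFieldTheory.Balaban1983to89.BlockAveragingEMLLinearised (stepFactor length_walk)
open Literature.MathematicalPhysics.QuantumFieldTheory.Balaban1983to89.BlockAveragingEMLLinearisedBackground
  (covStep covWalkSum covWalkSum_nil covWalkSum_cons covWalkSum_append covWalkSum_add covLinAvgR0 norm_covWalkSum_le covWalkSum_walk_wordRev)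
open Literature.MathematicalPhysics.QuantumFieldTheory.Balaban1983to89.B10StarCount (shift_unshift unshift_shift)
open Literature.MathematicalPhysics.QuantumFieldTheory.Balaban1983to89.Node00
open Literature.MathematicalPhysics.QuantumFieldTheory.Balaban1983to89.BlockAveragingEMLProp2 (shift_shift_comm walkEnd_stairWord_replicate loopHol_eq dist1_corr_le_two_mul)
open Summit.QuantumFields.YangMills.Theorems.FluctuationComparisonRegPrIntLS2BetaCovWalkSumStokes

variable {P : Params} {j : ℕ} {N : ℕ} [NeZero N]

/-! ## §3 The coarse plaquette sum of ANY bond field, expanded: four bond terms with their transports -/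

section PlaqExpand

/-- `((y + e_μ) + e_ν) − e_μ = y + e_ν` on the torus. [folklore] -/
theorem shift_shift_unshift {k : ℕ} (y : Site P k) (μ ν : Fin P.d) : ((y.shift μ).shift ν).unshift μ = y.shift ν := by
  rw [shift_shift_comm, unshift_shift]

omit [NeZero N] in
/-- **THE LINEARISED PLAQUETTE WORD EXPANDED**: `Y_V(walk y [μ⁺, ν⁺, μ̄, ν̄]) = Z(c₁) + V₁Z(c₂)V₁⋆ − T₃Z(c₃)T₃⋆ − T₄Z(c₄)T₄⋆` with `c₁ = ⟨y,μ⟩`, `c₂ = ⟨y+e_μ,ν⟩`,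
`c₃ = ⟨y+e_ν,μ⟩`, `c₄ = ⟨y,ν⟩`, `V_k = V(c_k)`, `T₃ = V₁V₂V₃⁻¹`, `T₄ = V₁V₂V₃⁻¹V₄⁻¹`. [cite: Balaban1985Averaging, (58) p.27, (9) p.19] -/
theorem covWalkSum_walk_plaq_eq {k : ℕ} (V : GaugeField P k (SU N)) (Z : PBond P k → Matrix (Fin N) (Fin N) ℂ) (y : Site P k) (μ ν : Fin P.d) :
    covWalkSum V Z (walk y [((μ, true) : Letter P.d), (ν, true), (μ, false), (ν, false)]) =
      Z ⟨y, μ⟩ + ((V ⟨y, μ⟩ : SU N) : Matrix (Fin N) (Fin N) ℂ) * Z ⟨y.shift μ, ν⟩ * star ((V ⟨y, μ⟩ : SU N) : Matrix (Fin N) (Fin N) ℂ) -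
        ((V ⟨y, μ⟩ * V ⟨y.shift μ, ν⟩ * (V ⟨y.shift ν, μ⟩)⁻¹ : SU N) : Matrix (Fin N) (Fin N) ℂ) * Z ⟨y.shift ν, μ⟩ *
          star ((V ⟨y, μ⟩ * V ⟨y.shift μ, ν⟩ * (V ⟨y.shift ν, μ⟩)⁻¹ : SU N) : Matrix (Fin N) (Fin N) ℂ) -
        ((V ⟨y, μ⟩ * V ⟨y.shift μ, ν⟩ * (V ⟨y.shift ν, μ⟩)⁻¹ * (V ⟨y, ν⟩)⁻¹ : SU N) : Matrix (Fin N) (Fin N) ℂ) * Z ⟨y, ν⟩ *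
          star ((V ⟨y, μ⟩ * V ⟨y.shift μ, ν⟩ * (V ⟨y.shift ν, μ⟩)⁻¹ * (V ⟨y, ν⟩)⁻¹ : SU N) : Matrix (Fin N) (Fin N) ℂ) := by
  simp only [walk, covWalkSum_cons, covWalkSum_nil, covStep, stepFactor, shift_shift_unshift, unshift_shift, Bool.false_eq_true, ↓reduceIte,
    Submonoid.coe_mul, coe_inv_SU, star_mul, star_star, mul_zero, zero_mul, add_zero]
  noncomm_ring

end PlaqExpand

/-! ## §4 The `a × b` rectangle sum of the FINE field, expanded: four straight-line sums with their transports -/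

section RectExpand

variable (U₀ : GaugeField P j (SU N)) (Y : PBond P j → Matrix (Fin N) (Fin N) ℂ)

/-- Straight walks in two directions commute at the level of end sites. [folklore] -/
theorem walkEnd_replicate_comm (x : Site P j) (μ ν : Fin P.d) (a b : ℕ) :
    walkEnd x (List.replicate a (μ, true) ++ List.replicate b (ν, true)) = walkEnd x (List.replicate b (ν, true) ++ List.replicate a (μ, true)) := by
  funext κ
  rw [walkEnd_apply, walkEnd_apply, T4ReflectionCone.netDisp_append, T4ReflectionCone.netDisp_append, add_comm (netDisp (List.replicate a (μ, true)) κ)]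

/-- **THE LINEARISED RECTANGLE WORD EXPANDED**: with `x₁ = x + a e_μ`, `x₃ = x + b e_ν`, the straight-line sums `S₁ = Y_{U₀}(μ^a @ x)`, `S₂ = Y_{U₀}(ν^b @ x₁)`,
`S₃ = Y_{U₀}(μ^a @ x₃)`, `S₄ = Y_{U₀}(ν^b @ x)` and their holonomies `B₁, B₂, B₃, B₄`:
`Y_{U₀}(walk x (μ^a ν^b μ̄^a ν̄^b)) = S₁ + B₁S₂B₁⋆ − (B₁B₂B₃⁻¹)S₃(B₁B₂B₃⁻¹)⋆ − (B₁B₂B₃⁻¹B₄⁻¹)S₄(B₁B₂B₃⁻¹B₄⁻¹)⋆`. [cite: Balaban1985Averaging, (58) p.27, (9)-(10) p.19] -/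
theorem covWalkSum_walk_rect_eq (x : Site P j) (μ ν : Fin P.d) (a b : ℕ) :
    covWalkSum U₀ Y (walk x (List.replicate a (μ, true) ++ List.replicate b (ν, true) ++ List.replicate a (μ, false) ++ List.replicate b (ν, false))) =
      covWalkSum U₀ Y (walk x (List.replicate a (μ, true))) +
        ((holAt U₀ (walk x (List.replicate a (μ, true))) : SU N) : Matrix (Fin N) (Fin N) ℂ) *
            covWalkSum U₀ Y (walk (walkEnd x (List.replicate a (μ, true))) (List.replicate b (ν, true))) *
          star ((holAt U₀ (walk x (List.replicate a (μ, true))) : SU N) : Matrix (Fin N) (Fin N) ℂ) -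
        ((holAt U₀ (walk x (List.replicate a (μ, true))) * holAt U₀ (walk (walkEnd x (List.replicate a (μ, true))) (List.replicate b (ν, true))) *
              (holAt U₀ (walk (walkEnd x (List.replicate b (ν, true))) (List.replicate a (μ, true))))⁻¹ : SU N) : Matrix (Fin N) (Fin N) ℂ) *
            covWalkSum U₀ Y (walk (walkEnd x (List.replicate b (ν, true))) (List.replicate a (μ, true))) *
          star ((holAt U₀ (walk x (List.replicate a (μ, true))) * holAt U₀ (walk (walkEnd x (List.replicate a (μ, true))) (List.replicate b (ν, true))) *
              (holAt U₀ (walk (walkEnd x (List.replicate b (ν, true))) (List.replicate a (μ, true))))⁻¹ : SU N) : Matrix (Fin N) (Fin N) ℂ) -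
        ((holAt U₀ (walk x (List.replicate a (μ, true))) * holAt U₀ (walk (walkEnd x (List.replicate a (μ, true))) (List.replicate b (ν, true))) *
              (holAt U₀ (walk (walkEnd x (List.replicate b (ν, true))) (List.replicate a (μ, true))))⁻¹ * (holAt U₀ (walk x (List.replicate b (ν, true))))⁻¹ : SU N) :
              Matrix (Fin N) (Fin N) ℂ) *
            covWalkSum U₀ Y (walk x (List.replicate b (ν, true))) *
          star ((holAt U₀ (walk x (List.replicate a (μ, true))) * holAt U₀ (walk (walkEnd x (List.replicate a (μ, true))) (List.replicate b (ν, true))) *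
              (holAt U₀ (walk (walkEnd x (List.replicate b (ν, true))) (List.replicate a (μ, true))))⁻¹ * (holAt U₀ (walk x (List.replicate b (ν, true))))⁻¹ : SU N) :
              Matrix (Fin N) (Fin N) ℂ) := by
  -- names
  set wμ : List (Letter P.d) := List.replicate a (μ, true) with hwμ
  set wν : List (Letter P.d) := List.replicate b (ν, true) with hwν
  set x₁ := walkEnd x wμ with hx₁
  set x₃ := walkEnd x wν with hx₃
  have hrevμ : List.replicate a ((μ, false) : Letter P.d) = wordRev wμ := by rw [hwμ, wordRev_replicate]; rfl
  have hrevν : List.replicate b ((ν, false) : Letter P.d) = wordRev wν := by rw [hwν, wordRev_replicate]; rfl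
  -- the corner `x₂ = x₁ + b e_ν = x₃ + a e_μ`
  have hx₂ : walkEnd x₁ wν = walkEnd x₃ wμ := by
    rw [hx₁, hx₃, ← walkEnd_append, ← walkEnd_append, walkEnd_replicate_comm]
  -- after three sides we are back at `x₃`
  have hx₃' : walkEnd x (wμ ++ wν ++ wordRev wμ) = x₃ := by
    rw [walkEnd_append, walkEnd_append, ← hx₁, hx₂, walkEnd_walkEnd_wordRev]
  rw [hrevμ, hrevν]
  rw [covWalkSum_walk_append U₀ Y x (wμ ++ wν ++ wordRev wμ) (wordRev wν), hx₃', covWalkSum_walk_wordRev U₀ Y x wν,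
    covWalkSum_walk_append U₀ Y x (wμ ++ wν) (wordRev wμ), walkEnd_append, ← hx₁, hx₂, covWalkSum_walk_wordRev U₀ Y x₃ wμ,
    covWalkSum_walk_append U₀ Y x wμ wν, ← hx₁]
  -- the holonomies of the partial words
  have hH₂ : holAt U₀ (walk x (wμ ++ wν)) = holAt U₀ (walk x wμ) * holAt U₀ (walk x₁ wν) := by rw [walk_append, holAt_append]
  have hH₃ : holAt U₀ (walk x (wμ ++ wν ++ wordRev wμ)) = holAt U₀ (walk x wμ) * holAt U₀ (walk x₁ wν) * (holAt U₀ (walk x₃ wμ))⁻¹ := by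
    rw [walk_append, holAt_append, hH₂, walkEnd_append, ← hx₁, hx₂, holAt_walk_wordRev]
  rw [hH₂, hH₃]
  simp only [Submonoid.coe_mul, coe_inv_SU, star_mul, star_star]
  noncomm_ring

end RectExpand

/-! ## §5 Transport mismatches: `‖T′ST′⋆ − TST⋆‖ ≤ 2·dist1(T⁻¹T′)·‖S‖`, and the three mismatches around the coarse plaquette are `O(α)` by the (0.4) loop identities -/

section Mismatch

/-- **CHANGING THE TRANSPORT COSTS ITS MISMATCH**: `‖T′·S·T′⋆ − T·S·T⋆‖ ≤ 2·dist1(T⁻¹T′)·‖S‖`. [cite: Balaban1985Averaging, (19)-(20) p.21 (bookkeeping)] -/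
theorem norm_conj_sub_conj_le (T T' : SU N) (S : Matrix (Fin N) (Fin N) ℂ) :
    ‖(T' : Matrix (Fin N) (Fin N) ℂ) * S * star (T' : Matrix (Fin N) (Fin N) ℂ) - (T : Matrix (Fin N) (Fin N) ℂ) * S * star (T : Matrix (Fin N) (Fin N) ℂ)‖ ≤
      2 * dist1 (T⁻¹ * T') * ‖S‖ := by
  have e : (T' : Matrix (Fin N) (Fin N) ℂ) = (T : Matrix (Fin N) (Fin N) ℂ) * ((T⁻¹ * T' : SU N) : Matrix (Fin N) (Fin N) ℂ) := by
    rw [← Submonoid.coe_mul, mul_inv_cancel_left]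
  have hTT : star (T : Matrix (Fin N) (Fin N) ℂ) * (T : Matrix (Fin N) (Fin N) ℂ) = 1 := star_coe_mul_coe_SU T
  set g : Matrix (Fin N) (Fin N) ℂ := ((T⁻¹ * T' : SU N) : Matrix (Fin N) (Fin N) ℂ) with hg
  have e2 : (T' : Matrix (Fin N) (Fin N) ℂ) * S * star (T' : Matrix (Fin N) (Fin N) ℂ) - (T : Matrix (Fin N) (Fin N) ℂ) * S * star (T : Matrix (Fin N) (Fin N) ℂ) =
      (T : Matrix (Fin N) (Fin N) ℂ) * (g * S * star g - S) * star (T : Matrix (Fin N) (Fin N) ℂ) := by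
    rw [e, star_mul]; noncomm_ring
  rw [e2]
  exact (norm_coe_conj_le T _).trans (norm_conj_sub_self_le _ _)

/-- `dist1 (h⁻¹·g·h) = dist1 g`. [folklore] -/
theorem dist1_inv_conj (g h : SU N) : dist1 (h⁻¹ * g * h) = dist1 g := by
  simpa using GaugeGroup.dist1_conj g h⁻¹

/-- **MISMATCH AT `c₂`**: with the (0.4) loop identity `B₁ = A⁻¹·W₁·a₁·A₂` (`W₁` the loop variable of `c₁` at index `(r,σ,σ)`, `a₁ = U₀(c₁)`, `A, A₂` the staircases from `emb y`, `emb (y+e_μ)`)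
and `V₁ = κ₁a₁`: `dist1((A·B₁)⁻¹·(κ₁a₁·A₂)) ≤ dist1 W₁ + dist1 κ₁`. [cite: Balaban1987RG1, (0.4) p.253] -/
theorem dist1_mismatch₂_le (A A₂ B₁ W₁ a₁ κ₁ : SU N) (hB₁ : B₁ = A⁻¹ * W₁ * a₁ * A₂) :
    dist1 ((A * B₁)⁻¹ * (κ₁ * a₁ * A₂)) ≤ dist1 W₁ + dist1 κ₁ := by
  subst hB₁
  have e : (A * (A⁻¹ * W₁ * a₁ * A₂))⁻¹ * (κ₁ * a₁ * A₂) = (a₁ * A₂)⁻¹ * (W₁⁻¹ * κ₁) * (a₁ * A₂) := by group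
  rw [e, dist1_inv_conj]
  calc dist1 (W₁⁻¹ * κ₁) ≤ dist1 W₁⁻¹ + dist1 κ₁ := GaugeGroup.dist1_mul_le _ _
    _ = dist1 W₁ + dist1 κ₁ := by rw [GaugeGroup.dist1_inv]

/-- **MISMATCH AT `c₃`**: with `B₁ = A⁻¹W₁a₁A₂`, `B₂ = A₂⁻¹W₂a₂A₂₃`, `B₃ = A₃⁻¹W₃a₃A₂₃`:
`dist1((A·B₁B₂B₃⁻¹)⁻¹·(κ₁a₁·κ₂a₂·(κ₃a₃)⁻¹·A₃)) ≤ Σ_{k≤3} dist1 W_k + Σ_{k≤3} dist1 κ_k` (the axial transporters cancel in conjugate pairs). [cite: Balaban1987RG1, (0.4) p.253] -/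
theorem dist1_mismatch₃_le (A A₂ A₃ A₂₃ B₁ B₂ B₃ W₁ W₂ W₃ a₁ a₂ a₃ κ₁ κ₂ κ₃ : SU N) (hB₁ : B₁ = A⁻¹ * W₁ * a₁ * A₂) (hB₂ : B₂ = A₂⁻¹ * W₂ * a₂ * A₂₃)
    (hB₃ : B₃ = A₃⁻¹ * W₃ * a₃ * A₂₃) :
    dist1 ((A * B₁ * B₂ * B₃⁻¹)⁻¹ * (κ₁ * a₁ * (κ₂ * a₂) * (κ₃ * a₃)⁻¹ * A₃)) ≤
      (dist1 W₁ + dist1 W₂ + dist1 W₃) + (dist1 κ₁ + dist1 κ₂ + dist1 κ₃) := by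
  subst hB₁ hB₂ hB₃
  have e : (A * (A⁻¹ * W₁ * a₁ * A₂) * (A₂⁻¹ * W₂ * a₂ * A₂₃) * (A₃⁻¹ * W₃ * a₃ * A₂₃)⁻¹)⁻¹ * (κ₁ * a₁ * (κ₂ * a₂) * (κ₃ * a₃)⁻¹ * A₃) =
      A₃⁻¹ * (W₃ * ((a₃ * a₂⁻¹) * W₂⁻¹ * (a₃ * a₂⁻¹)⁻¹) * ((a₃ * a₂⁻¹ * a₁⁻¹) * (W₁⁻¹ * κ₁) * (a₃ * a₂⁻¹ * a₁⁻¹)⁻¹) *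
        ((a₃ * a₂⁻¹) * κ₂ * (a₃ * a₂⁻¹)⁻¹) * κ₃⁻¹) * A₃ := by group
  rw [e, dist1_inv_conj]
  have h1 : dist1 ((a₃ * a₂⁻¹) * W₂⁻¹ * (a₃ * a₂⁻¹)⁻¹) = dist1 W₂ := by rw [GaugeGroup.dist1_conj, GaugeGroup.dist1_inv]
  have h2 : dist1 ((a₃ * a₂⁻¹ * a₁⁻¹) * (W₁⁻¹ * κ₁) * (a₃ * a₂⁻¹ * a₁⁻¹)⁻¹) ≤ dist1 W₁ + dist1 κ₁ := by
    rw [GaugeGroup.dist1_conj]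
    calc dist1 (W₁⁻¹ * κ₁) ≤ dist1 W₁⁻¹ + dist1 κ₁ := GaugeGroup.dist1_mul_le _ _
      _ = dist1 W₁ + dist1 κ₁ := by rw [GaugeGroup.dist1_inv]
  have h3 : dist1 ((a₃ * a₂⁻¹) * κ₂ * (a₃ * a₂⁻¹)⁻¹) = dist1 κ₂ := GaugeGroup.dist1_conj _ _
  have h4 : dist1 κ₃⁻¹ = dist1 κ₃ := GaugeGroup.dist1_inv _
  have t := GaugeGroup.dist1_mul_le (W₃ * ((a₃ * a₂⁻¹) * W₂⁻¹ * (a₃ * a₂⁻¹)⁻¹) * ((a₃ * a₂⁻¹ * a₁⁻¹) * (W₁⁻¹ * κ₁) * (a₃ * a₂⁻¹ * a₁⁻¹)⁻¹) *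
        ((a₃ * a₂⁻¹) * κ₂ * (a₃ * a₂⁻¹)⁻¹)) κ₃⁻¹
  have t2 := GaugeGroup.dist1_mul_le (W₃ * ((a₃ * a₂⁻¹) * W₂⁻¹ * (a₃ * a₂⁻¹)⁻¹) * ((a₃ * a₂⁻¹ * a₁⁻¹) * (W₁⁻¹ * κ₁) * (a₃ * a₂⁻¹ * a₁⁻¹)⁻¹))
        ((a₃ * a₂⁻¹) * κ₂ * (a₃ * a₂⁻¹)⁻¹)
  have t3 := GaugeGroup.dist1_mul_le (W₃ * ((a₃ * a₂⁻¹) * W₂⁻¹ * (a₃ * a₂⁻¹)⁻¹)) ((a₃ * a₂⁻¹ * a₁⁻¹) * (W₁⁻¹ * κ₁) * (a₃ * a₂⁻¹ * a₁⁻¹)⁻¹)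
  have t4 := GaugeGroup.dist1_mul_le W₃ ((a₃ * a₂⁻¹) * W₂⁻¹ * (a₃ * a₂⁻¹)⁻¹)
  linarith

/-- **MISMATCH AT `c₄`**: with in addition `B₄ = A⁻¹W₄a₄A₃`:
`dist1((A·B₁B₂B₃⁻¹B₄⁻¹)⁻¹·(κ₁a₁·κ₂a₂·(κ₃a₃)⁻¹·(κ₄a₄)⁻¹·A)) ≤ Σ_{k≤4} dist1 W_k + Σ_{k≤4} dist1 κ_k`. [cite: Balaban1987RG1, (0.4) p.253] -/
theorem dist1_mismatch₄_le (A A₂ A₃ A₂₃ B₁ B₂ B₃ B₄ W₁ W₂ W₃ W₄ a₁ a₂ a₃ a₄ κ₁ κ₂ κ₃ κ₄ : SU N) (hB₁ : B₁ = A⁻¹ * W₁ * a₁ * A₂)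
    (hB₂ : B₂ = A₂⁻¹ * W₂ * a₂ * A₂₃) (hB₃ : B₃ = A₃⁻¹ * W₃ * a₃ * A₂₃) (hB₄ : B₄ = A⁻¹ * W₄ * a₄ * A₃) :
    dist1 ((A * B₁ * B₂ * B₃⁻¹ * B₄⁻¹)⁻¹ * (κ₁ * a₁ * (κ₂ * a₂) * (κ₃ * a₃)⁻¹ * (κ₄ * a₄)⁻¹ * A)) ≤
      (dist1 W₁ + dist1 W₂ + dist1 W₃ + dist1 W₄) + (dist1 κ₁ + dist1 κ₂ + dist1 κ₃ + dist1 κ₄) := by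
  subst hB₁ hB₂ hB₃ hB₄
  have e : (A * (A⁻¹ * W₁ * a₁ * A₂) * (A₂⁻¹ * W₂ * a₂ * A₂₃) * (A₃⁻¹ * W₃ * a₃ * A₂₃)⁻¹ * (A⁻¹ * W₄ * a₄ * A₃)⁻¹)⁻¹ *
        (κ₁ * a₁ * (κ₂ * a₂) * (κ₃ * a₃)⁻¹ * (κ₄ * a₄)⁻¹ * A) =
      A⁻¹ * (W₄ * (a₄ * W₃ * a₄⁻¹) * ((a₄ * a₃ * a₂⁻¹) * W₂⁻¹ * (a₄ * a₃ * a₂⁻¹)⁻¹) *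
        ((a₄ * a₃ * a₂⁻¹ * a₁⁻¹) * (W₁⁻¹ * κ₁) * (a₄ * a₃ * a₂⁻¹ * a₁⁻¹)⁻¹) * ((a₄ * a₃ * a₂⁻¹) * κ₂ * (a₄ * a₃ * a₂⁻¹)⁻¹) *
        (a₄ * κ₃⁻¹ * a₄⁻¹) * κ₄⁻¹) * A := by group
  rw [e, dist1_inv_conj]
  have h0 : dist1 (a₄ * W₃ * a₄⁻¹) = dist1 W₃ := GaugeGroup.dist1_conj _ _
  have h1 : dist1 ((a₄ * a₃ * a₂⁻¹) * W₂⁻¹ * (a₄ * a₃ * a₂⁻¹)⁻¹) = dist1 W₂ := by rw [GaugeGroup.dist1_conj, GaugeGroup.dist1_inv]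
  have h2 : dist1 ((a₄ * a₃ * a₂⁻¹ * a₁⁻¹) * (W₁⁻¹ * κ₁) * (a₄ * a₃ * a₂⁻¹ * a₁⁻¹)⁻¹) ≤ dist1 W₁ + dist1 κ₁ := by
    rw [GaugeGroup.dist1_conj]
    calc dist1 (W₁⁻¹ * κ₁) ≤ dist1 W₁⁻¹ + dist1 κ₁ := GaugeGroup.dist1_mul_le _ _
      _ = dist1 W₁ + dist1 κ₁ := by rw [GaugeGroup.dist1_inv]
  have h3 : dist1 ((a₄ * a₃ * a₂⁻¹) * κ₂ * (a₄ * a₃ * a₂⁻¹)⁻¹) = dist1 κ₂ := GaugeGroup.dist1_conj _ _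
  have h4 : dist1 (a₄ * κ₃⁻¹ * a₄⁻¹) = dist1 κ₃ := by rw [GaugeGroup.dist1_conj, GaugeGroup.dist1_inv]
  have h5 : dist1 κ₄⁻¹ = dist1 κ₄ := GaugeGroup.dist1_inv _
  have t1 := GaugeGroup.dist1_mul_le (W₄ * (a₄ * W₃ * a₄⁻¹) * ((a₄ * a₃ * a₂⁻¹) * W₂⁻¹ * (a₄ * a₃ * a₂⁻¹)⁻¹) *
        ((a₄ * a₃ * a₂⁻¹ * a₁⁻¹) * (W₁⁻¹ * κ₁) * (a₄ * a₃ * a₂⁻¹ * a₁⁻¹)⁻¹) * ((a₄ * a₃ * a₂⁻¹) * κ₂ * (a₄ * a₃ * a₂⁻¹)⁻¹) *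
        (a₄ * κ₃⁻¹ * a₄⁻¹)) κ₄⁻¹
  have t2 := GaugeGroup.dist1_mul_le (W₄ * (a₄ * W₃ * a₄⁻¹) * ((a₄ * a₃ * a₂⁻¹) * W₂⁻¹ * (a₄ * a₃ * a₂⁻¹)⁻¹) *
        ((a₄ * a₃ * a₂⁻¹ * a₁⁻¹) * (W₁⁻¹ * κ₁) * (a₄ * a₃ * a₂⁻¹ * a₁⁻¹)⁻¹) * ((a₄ * a₃ * a₂⁻¹) * κ₂ * (a₄ * a₃ * a₂⁻¹)⁻¹))
        (a₄ * κ₃⁻¹ * a₄⁻¹)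
  have t3 := GaugeGroup.dist1_mul_le (W₄ * (a₄ * W₃ * a₄⁻¹) * ((a₄ * a₃ * a₂⁻¹) * W₂⁻¹ * (a₄ * a₃ * a₂⁻¹)⁻¹) *
        ((a₄ * a₃ * a₂⁻¹ * a₁⁻¹) * (W₁⁻¹ * κ₁) * (a₄ * a₃ * a₂⁻¹ * a₁⁻¹)⁻¹)) ((a₄ * a₃ * a₂⁻¹) * κ₂ * (a₄ * a₃ * a₂⁻¹)⁻¹)
  have t4 := GaugeGroup.dist1_mul_le (W₄ * (a₄ * W₃ * a₄⁻¹) * ((a₄ * a₃ * a₂⁻¹) * W₂⁻¹ * (a₄ * a₃ * a₂⁻¹)⁻¹))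
        ((a₄ * a₃ * a₂⁻¹ * a₁⁻¹) * (W₁⁻¹ * κ₁) * (a₄ * a₃ * a₂⁻¹ * a₁⁻¹)⁻¹)
  have t5 := GaugeGroup.dist1_mul_le (W₄ * (a₄ * W₃ * a₄⁻¹)) ((a₄ * a₃ * a₂⁻¹) * W₂⁻¹ * (a₄ * a₃ * a₂⁻¹)⁻¹)
  have t6 := GaugeGroup.dist1_mul_le W₄ (a₄ * W₃ * a₄⁻¹)
  linarith

/-- **THE (0.4) LOOP IDENTITY SOLVED FOR THE LINE HOLONOMY**: `U₀([x_i, x_i′]) = A_i⁻¹ · W_i · U₀(c) · A_i′` (`A_i, A_i′` the staircases from `emb c₋`, `emb c₊`). [cite: Balaban1987RG1, (0.4) p.253] -/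
theorem holAt_line_eq_of_loopHol (U₀ : GaugeField P j (SU N)) (c : PBond P (j + 1)) (i : Idx P) :
    holAt U₀ (walk (walkEnd (emb c.src) (stairWord i.2.1 (off i.1))) (List.replicate P.L (c.dir, true))) =
      (holAt U₀ (walk (emb c.src) (stairWord i.2.1 (off i.1))))⁻¹ * loopHol U₀ c i * AveragingRT.axialAvg U₀ c * holAt U₀ (walk (emb c.tgt) (stairWord i.2.2 (off i.1))) := by
  rw [loopHol_eq]; group

end Mismatch

/-! ## §6 ★★ Per comb index: the four transported line terms around `∂p′` versus the transported `L × L` square at `x_i` -/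

section PerIndex

/-- ★★ **PER INDEX `i = (r, σ, ·)`, THE COARSE-TRANSPORTED LINE TERMS AROUND `∂p′` ARE THE COMB-TRANSPORTED LINEARISED `L × L` SQUARE AT `x_i` UP TO `48·α·L·M`**:
with `A^{(z)} = U₀(Γ^σ_{emb z → x^{(z)}})`, the straight-line sums `S_k = Y_{U₀}([x^{(c_k₋)}, x^{(c_k₋)} + L e_{dir c_k}])` at the four bonds `c₁ = ⟨y,μ⟩, c₂ = ⟨y+e_μ,ν⟩, c₃ = ⟨y+e_ν,μ⟩, c₄ = ⟨y,ν⟩` of `∂p′`,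
the coarse transports `T′₁ = A, T′₂ = Ū(c₁)A^{(y+e_μ)}, T′₃ = Ū(c₁)Ū(c₂)Ū(c₃)⁻¹A^{(y+e_ν)}, T′₄ = Ū(∂p′…)A` (`Ū = avgFun ℰ U₀`), and the square word `μ^L ν^L μ̄^L ν̄^L` at `x_i = x^{(y)}`:
`‖[T′₁S₁T′₁⋆ + T′₂S₂T′₂⋆ − T′₃S₃T′₃⋆ − T′₄S₄T′₄⋆] − A·Y_{U₀}(∂R_{L×L}(x_i))·A⋆‖ ≤ 48·α·(L·M)` — the fine transports of the expanded square (§4) differ from the coarse ones by the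
mismatches of §5 (`≤ 3α, 9α, 12α`, loop guard `α` at the four bonds, `dist1 κ ≤ 2α` by ✓`dist1_corr_le_two_mul`), each line sum has norm `≤ L·M`. [cite: Balaban1987RG1, (0.4) p.253; Balaban1985Averaging, (58) p.27, (124)-(125) p.36] -/
theorem norm_lineTerms_sub_conj_rect_le (U₀ : GaugeField P j (SU N)) (Y : PBond P j → Matrix (Fin N) (Fin N) ℂ) {α : ℝ}
    (hα : ∀ (c : PBond P (j + 1)) (i : Idx P), dist1 (loopHol U₀ c i) ≤ α) (hαδ : α < deltaSU (Fin N)) (hα6 : α ≤ 1 / 6) {M : ℝ} (hY : ∀ b, ‖Y b‖ ≤ M)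
    (y : Site P (j + 1)) (μ ν : Fin P.d) (i : Idx P) :
    ‖((holAt U₀ (walk (emb y) (stairWord i.2.1 (off i.1))) : SU N) : Matrix (Fin N) (Fin N) ℂ) *
            covWalkSum U₀ Y (walk (walkEnd (emb y) (stairWord i.2.1 (off i.1))) (List.replicate P.L (μ, true))) *
          star ((holAt U₀ (walk (emb y) (stairWord i.2.1 (off i.1))) : SU N) : Matrix (Fin N) (Fin N) ℂ) +
        ((avgFun (expMeanLogSU (n := Fin N)) U₀ ⟨y, μ⟩ : SU N) : Matrix (Fin N) (Fin N) ℂ) *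
            (((holAt U₀ (walk (emb (y.shift μ)) (stairWord i.2.1 (off i.1))) : SU N) : Matrix (Fin N) (Fin N) ℂ) *
                covWalkSum U₀ Y (walk (walkEnd (emb (y.shift μ)) (stairWord i.2.1 (off i.1))) (List.replicate P.L (ν, true))) *
              star ((holAt U₀ (walk (emb (y.shift μ)) (stairWord i.2.1 (off i.1))) : SU N) : Matrix (Fin N) (Fin N) ℂ)) *
          star ((avgFun (expMeanLogSU (n := Fin N)) U₀ ⟨y, μ⟩ : SU N) : Matrix (Fin N) (Fin N) ℂ) -
        ((avgFun (expMeanLogSU (n := Fin N)) U₀ ⟨y, μ⟩ * avgFun (expMeanLogSU (n := Fin N)) U₀ ⟨y.shift μ, ν⟩ * (avgFun (expMeanLogSU (n := Fin N)) U₀ ⟨y.shift ν, μ⟩)⁻¹ : SU N) :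
              Matrix (Fin N) (Fin N) ℂ) *
            (((holAt U₀ (walk (emb (y.shift ν)) (stairWord i.2.1 (off i.1))) : SU N) : Matrix (Fin N) (Fin N) ℂ) *
                covWalkSum U₀ Y (walk (walkEnd (emb (y.shift ν)) (stairWord i.2.1 (off i.1))) (List.replicate P.L (μ, true))) *
              star ((holAt U₀ (walk (emb (y.shift ν)) (stairWord i.2.1 (off i.1))) : SU N) : Matrix (Fin N) (Fin N) ℂ)) *
          star ((avgFun (expMeanLogSU (n := Fin N)) U₀ ⟨y, μ⟩ * avgFun (expMeanLogSU (n := Fin N)) U₀ ⟨y.shift μ, ν⟩ * (avgFun (expMeanLogSU (n := Fin N)) U₀ ⟨y.shift ν, μ⟩)⁻¹ : SU N) :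
              Matrix (Fin N) (Fin N) ℂ) -
        ((avgFun (expMeanLogSU (n := Fin N)) U₀ ⟨y, μ⟩ * avgFun (expMeanLogSU (n := Fin N)) U₀ ⟨y.shift μ, ν⟩ * (avgFun (expMeanLogSU (n := Fin N)) U₀ ⟨y.shift ν, μ⟩)⁻¹ *
              (avgFun (expMeanLogSU (n := Fin N)) U₀ ⟨y, ν⟩)⁻¹ : SU N) : Matrix (Fin N) (Fin N) ℂ) *
            (((holAt U₀ (walk (emb y) (stairWord i.2.1 (off i.1))) : SU N) : Matrix (Fin N) (Fin N) ℂ) *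
                covWalkSum U₀ Y (walk (walkEnd (emb y) (stairWord i.2.1 (off i.1))) (List.replicate P.L (ν, true))) *
              star ((holAt U₀ (walk (emb y) (stairWord i.2.1 (off i.1))) : SU N) : Matrix (Fin N) (Fin N) ℂ)) *
          star ((avgFun (expMeanLogSU (n := Fin N)) U₀ ⟨y, μ⟩ * avgFun (expMeanLogSU (n := Fin N)) U₀ ⟨y.shift μ, ν⟩ * (avgFun (expMeanLogSU (n := Fin N)) U₀ ⟨y.shift ν, μ⟩)⁻¹ *
              (avgFun (expMeanLogSU (n := Fin N)) U₀ ⟨y, ν⟩)⁻¹ : SU N) : Matrix (Fin N) (Fin N) ℂ) -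
      ((holAt U₀ (walk (emb y) (stairWord i.2.1 (off i.1))) : SU N) : Matrix (Fin N) (Fin N) ℂ) *
          covWalkSum U₀ Y (walk (walkEnd (emb y) (stairWord i.2.1 (off i.1)))
            (List.replicate P.L (μ, true) ++ List.replicate P.L (ν, true) ++ List.replicate P.L (μ, false) ++ List.replicate P.L (ν, false))) *
        star ((holAt U₀ (walk (emb y) (stairWord i.2.1 (off i.1))) : SU N) : Matrix (Fin N) (Fin N) ℂ)‖ ≤ 48 * α * ((P.L : ℝ) * M) := by
  obtain ⟨r, σ, σ'⟩ := i
  simp only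
  -- names: staircases, lines, line sums
  set s : List (Letter P.d) := stairWord σ (off r) with hs
  set x : Site P j := walkEnd (emb y) s with hx
  set A : SU N := holAt U₀ (walk (emb y) s) with hA
  set A₂ : SU N := holAt U₀ (walk (emb (y.shift μ)) s) with hA₂
  set A₃ : SU N := holAt U₀ (walk (emb (y.shift ν)) s) with hA₃
  set A₂₃ : SU N := holAt U₀ (walk (emb ((y.shift μ).shift ν)) s) with hA₂₃
  set B₁ : SU N := holAt U₀ (walk x (List.replicate P.L (μ, true))) with hB₁
  set B₂ : SU N := holAt U₀ (walk (walkEnd (emb (y.shift μ)) s) (List.replicate P.L (ν, true))) with hB₂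
  set B₃ : SU N := holAt U₀ (walk (walkEnd (emb (y.shift ν)) s) (List.replicate P.L (μ, true))) with hB₃
  set B₄ : SU N := holAt U₀ (walk x (List.replicate P.L (ν, true))) with hB₄
  set S₁ := covWalkSum U₀ Y (walk x (List.replicate P.L (μ, true))) with hS₁
  set S₂ := covWalkSum U₀ Y (walk (walkEnd (emb (y.shift μ)) s) (List.replicate P.L (ν, true))) with hS₂
  set S₃ := covWalkSum U₀ Y (walk (walkEnd (emb (y.shift ν)) s) (List.replicate P.L (μ, true))) with hS₃
  set S₄ := covWalkSum U₀ Y (walk x (List.replicate P.L (ν, true))) with hS₄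
  set V₁ : SU N := avgFun (expMeanLogSU (n := Fin N)) U₀ ⟨y, μ⟩ with hV₁
  set V₂ : SU N := avgFun (expMeanLogSU (n := Fin N)) U₀ ⟨y.shift μ, ν⟩ with hV₂
  set V₃ : SU N := avgFun (expMeanLogSU (n := Fin N)) U₀ ⟨y.shift ν, μ⟩ with hV₃
  set V₄ : SU N := avgFun (expMeanLogSU (n := Fin N)) U₀ ⟨y, ν⟩ with hV₄
  -- the square expanded (§4), its corners identified with the neighbouring comb points
  have hrect := covWalkSum_walk_rect_eq U₀ Y x μ ν P.L P.L
  have hxμ : walkEnd x (List.replicate P.L (μ, true)) = walkEnd (emb (y.shift μ)) s := by rw [hx, hs, walkEnd_stairWord_replicate y μ σ σ (off r)]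
  have hxν : walkEnd x (List.replicate P.L (ν, true)) = walkEnd (emb (y.shift ν)) s := by rw [hx, hs, walkEnd_stairWord_replicate y ν σ σ (off r)]
  rw [hxμ, hxν] at hrect
  rw [hrect]
  -- regroup: the first terms cancel, three transport mismatches remain
  have e : (A : Matrix (Fin N) (Fin N) ℂ) * S₁ * star (A : Matrix (Fin N) (Fin N) ℂ) +
        (V₁ : Matrix (Fin N) (Fin N) ℂ) * ((A₂ : Matrix (Fin N) (Fin N) ℂ) * S₂ * star (A₂ : Matrix (Fin N) (Fin N) ℂ)) * star (V₁ : Matrix (Fin N) (Fin N) ℂ) -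
        ((V₁ * V₂ * V₃⁻¹ : SU N) : Matrix (Fin N) (Fin N) ℂ) * ((A₃ : Matrix (Fin N) (Fin N) ℂ) * S₃ * star (A₃ : Matrix (Fin N) (Fin N) ℂ)) * star ((V₁ * V₂ * V₃⁻¹ : SU N) : Matrix (Fin N) (Fin N) ℂ) -
        ((V₁ * V₂ * V₃⁻¹ * V₄⁻¹ : SU N) : Matrix (Fin N) (Fin N) ℂ) * ((A : Matrix (Fin N) (Fin N) ℂ) * S₄ * star (A : Matrix (Fin N) (Fin N) ℂ)) *
          star ((V₁ * V₂ * V₃⁻¹ * V₄⁻¹ : SU N) : Matrix (Fin N) (Fin N) ℂ) -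
      (A : Matrix (Fin N) (Fin N) ℂ) * (S₁ + (B₁ : Matrix (Fin N) (Fin N) ℂ) * S₂ * star (B₁ : Matrix (Fin N) (Fin N) ℂ) -
          ((B₁ * B₂ * B₃⁻¹ : SU N) : Matrix (Fin N) (Fin N) ℂ) * S₃ * star ((B₁ * B₂ * B₃⁻¹ : SU N) : Matrix (Fin N) (Fin N) ℂ) -
          ((B₁ * B₂ * B₃⁻¹ * B₄⁻¹ : SU N) : Matrix (Fin N) (Fin N) ℂ) * S₄ * star ((B₁ * B₂ * B₃⁻¹ * B₄⁻¹ : SU N) : Matrix (Fin N) (Fin N) ℂ)) * star (A : Matrix (Fin N) (Fin N) ℂ) =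
      (((V₁ * A₂ : SU N) : Matrix (Fin N) (Fin N) ℂ) * S₂ * star ((V₁ * A₂ : SU N) : Matrix (Fin N) (Fin N) ℂ) -
          ((A * B₁ : SU N) : Matrix (Fin N) (Fin N) ℂ) * S₂ * star ((A * B₁ : SU N) : Matrix (Fin N) (Fin N) ℂ)) -
        (((V₁ * V₂ * V₃⁻¹ * A₃ : SU N) : Matrix (Fin N) (Fin N) ℂ) * S₃ * star ((V₁ * V₂ * V₃⁻¹ * A₃ : SU N) : Matrix (Fin N) (Fin N) ℂ) -
          ((A * B₁ * B₂ * B₃⁻¹ : SU N) : Matrix (Fin N) (Fin N) ℂ) * S₃ * star ((A * B₁ * B₂ * B₃⁻¹ : SU N) : Matrix (Fin N) (Fin N) ℂ)) -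
        (((V₁ * V₂ * V₃⁻¹ * V₄⁻¹ * A : SU N) : Matrix (Fin N) (Fin N) ℂ) * S₄ * star ((V₁ * V₂ * V₃⁻¹ * V₄⁻¹ * A : SU N) : Matrix (Fin N) (Fin N) ℂ) -
          ((A * B₁ * B₂ * B₃⁻¹ * B₄⁻¹ : SU N) : Matrix (Fin N) (Fin N) ℂ) * S₄ * star ((A * B₁ * B₂ * B₃⁻¹ * B₄⁻¹ : SU N) : Matrix (Fin N) (Fin N) ℂ)) := by
    simp only [Submonoid.coe_mul, coe_inv_SU, star_mul, star_star]
    noncomm_ring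
  rw [e]
  -- the (0.4) loop identities at the four bonds, index `(r, σ, σ)`
  have hB₁' : B₁ = A⁻¹ * loopHol U₀ ⟨y, μ⟩ (r, σ, σ) * AveragingRT.axialAvg U₀ ⟨y, μ⟩ * A₂ := by
    have h := holAt_line_eq_of_loopHol U₀ ⟨y, μ⟩ (r, σ, σ)
    simpa [PBond.tgt] using h
  have hB₂' : B₂ = A₂⁻¹ * loopHol U₀ ⟨y.shift μ, ν⟩ (r, σ, σ) * AveragingRT.axialAvg U₀ ⟨y.shift μ, ν⟩ * A₂₃ := by
    have h := holAt_line_eq_of_loopHol U₀ ⟨y.shift μ, ν⟩ (r, σ, σ)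
    simpa [PBond.tgt] using h
  have hB₃' : B₃ = A₃⁻¹ * loopHol U₀ ⟨y.shift ν, μ⟩ (r, σ, σ) * AveragingRT.axialAvg U₀ ⟨y.shift ν, μ⟩ * A₂₃ := by
    have h := holAt_line_eq_of_loopHol U₀ ⟨y.shift ν, μ⟩ (r, σ, σ)
    rw [hA₂₃, shift_shift_comm y μ ν]
    simpa [PBond.tgt] using h
  have hB₄' : B₄ = A⁻¹ * loopHol U₀ ⟨y, ν⟩ (r, σ, σ) * AveragingRT.axialAvg U₀ ⟨y, ν⟩ * A₃ := by
    have h := holAt_line_eq_of_loopHol U₀ ⟨y, ν⟩ (r, σ, σ)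
    simpa [PBond.tgt] using h
  -- sizes
  have hα0 : 0 ≤ α := (GaugeGroup.dist1_nonneg _).trans (hα ⟨y, μ⟩ (r, σ, σ))
  have hM0 : 0 ≤ M := (norm_nonneg _).trans (hY ⟨x, μ⟩)
  have hκ : ∀ c : PBond P (j + 1), dist1 (corr (expMeanLogSU (n := Fin N)) U₀ c) ≤ 2 * α := fun c => dist1_corr_le_two_mul U₀ c (hα c) hαδ hα6
  have hline : ∀ (z : Site P j) (κ : Fin P.d), ‖covWalkSum U₀ Y (walk z (List.replicate P.L (κ, true)))‖ ≤ (P.L : ℝ) * M := by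
    intro z κ
    have h := norm_covWalkSum_le U₀ hY (walk z (List.replicate P.L (κ, true)))
    rwa [length_walk, List.length_replicate] at h
  -- the three mismatches
  -- the three mismatches (`Ū(c) = κ_c · a_c` definitionally)
  have eV₁ : V₁ = corr (expMeanLogSU (n := Fin N)) U₀ ⟨y, μ⟩ * AveragingRT.axialAvg U₀ ⟨y, μ⟩ := rfl
  have eV₂ : V₂ = corr (expMeanLogSU (n := Fin N)) U₀ ⟨y.shift μ, ν⟩ * AveragingRT.axialAvg U₀ ⟨y.shift μ, ν⟩ := rfl
  have eV₃ : V₃ = corr (expMeanLogSU (n := Fin N)) U₀ ⟨y.shift ν, μ⟩ * AveragingRT.axialAvg U₀ ⟨y.shift ν, μ⟩ := rfl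
  have eV₄ : V₄ = corr (expMeanLogSU (n := Fin N)) U₀ ⟨y, ν⟩ * AveragingRT.axialAvg U₀ ⟨y, ν⟩ := rfl
  have hg₂ : dist1 ((A * B₁)⁻¹ * (V₁ * A₂)) ≤ 3 * α := by
    have h := dist1_mismatch₂_le A A₂ B₁ _ _ (corr (expMeanLogSU (n := Fin N)) U₀ ⟨y, μ⟩) hB₁'
    rw [eV₁]; linarith [hα ⟨y, μ⟩ (r, σ, σ), hκ ⟨y, μ⟩]
  have hg₃ : dist1 ((A * B₁ * B₂ * B₃⁻¹)⁻¹ * (V₁ * V₂ * V₃⁻¹ * A₃)) ≤ 9 * α := by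
    have h := dist1_mismatch₃_le A A₂ A₃ A₂₃ B₁ B₂ B₃ _ _ _ _ _ _ (corr (expMeanLogSU (n := Fin N)) U₀ ⟨y, μ⟩) (corr (expMeanLogSU (n := Fin N)) U₀ ⟨y.shift μ, ν⟩)
      (corr (expMeanLogSU (n := Fin N)) U₀ ⟨y.shift ν, μ⟩) hB₁' hB₂' hB₃'
    rw [eV₁, eV₂, eV₃]; linarith [hα ⟨y, μ⟩ (r, σ, σ), hα ⟨y.shift μ, ν⟩ (r, σ, σ), hα ⟨y.shift ν, μ⟩ (r, σ, σ), hκ ⟨y, μ⟩, hκ ⟨y.shift μ, ν⟩, hκ ⟨y.shift ν, μ⟩]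
  have hg₄ : dist1 ((A * B₁ * B₂ * B₃⁻¹ * B₄⁻¹)⁻¹ * (V₁ * V₂ * V₃⁻¹ * V₄⁻¹ * A)) ≤ 12 * α := by
    have h := dist1_mismatch₄_le A A₂ A₃ A₂₃ B₁ B₂ B₃ B₄ _ _ _ _ _ _ _ _ (corr (expMeanLogSU (n := Fin N)) U₀ ⟨y, μ⟩) (corr (expMeanLogSU (n := Fin N)) U₀ ⟨y.shift μ, ν⟩)
      (corr (expMeanLogSU (n := Fin N)) U₀ ⟨y.shift ν, μ⟩) (corr (expMeanLogSU (n := Fin N)) U₀ ⟨y, ν⟩) hB₁' hB₂' hB₃' hB₄'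
    rw [eV₁, eV₂, eV₃, eV₄]; linarith [hα ⟨y, μ⟩ (r, σ, σ), hα ⟨y.shift μ, ν⟩ (r, σ, σ), hα ⟨y.shift ν, μ⟩ (r, σ, σ), hα ⟨y, ν⟩ (r, σ, σ), hκ ⟨y, μ⟩, hκ ⟨y.shift μ, ν⟩,
      hκ ⟨y.shift ν, μ⟩, hκ ⟨y, ν⟩]
  -- the three differences
  have h2 : ‖((V₁ * A₂ : SU N) : Matrix (Fin N) (Fin N) ℂ) * S₂ * star ((V₁ * A₂ : SU N) : Matrix (Fin N) (Fin N) ℂ) -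
      ((A * B₁ : SU N) : Matrix (Fin N) (Fin N) ℂ) * S₂ * star ((A * B₁ : SU N) : Matrix (Fin N) (Fin N) ℂ)‖ ≤ 2 * (3 * α) * ((P.L : ℝ) * M) :=
    (norm_conj_sub_conj_le _ _ _).trans (mul_le_mul (mul_le_mul_of_nonneg_left hg₂ (by norm_num)) (hline _ _) (norm_nonneg _) (by positivity))
  have h3 : ‖((V₁ * V₂ * V₃⁻¹ * A₃ : SU N) : Matrix (Fin N) (Fin N) ℂ) * S₃ * star ((V₁ * V₂ * V₃⁻¹ * A₃ : SU N) : Matrix (Fin N) (Fin N) ℂ) -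
      ((A * B₁ * B₂ * B₃⁻¹ : SU N) : Matrix (Fin N) (Fin N) ℂ) * S₃ * star ((A * B₁ * B₂ * B₃⁻¹ : SU N) : Matrix (Fin N) (Fin N) ℂ)‖ ≤ 2 * (9 * α) * ((P.L : ℝ) * M) :=
    (norm_conj_sub_conj_le _ _ _).trans (mul_le_mul (mul_le_mul_of_nonneg_left hg₃ (by norm_num)) (hline _ _) (norm_nonneg _) (by positivity))
  have h4 : ‖((V₁ * V₂ * V₃⁻¹ * V₄⁻¹ * A : SU N) : Matrix (Fin N) (Fin N) ℂ) * S₄ * star ((V₁ * V₂ * V₃⁻¹ * V₄⁻¹ * A : SU N) : Matrix (Fin N) (Fin N) ℂ) -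
      ((A * B₁ * B₂ * B₃⁻¹ * B₄⁻¹ : SU N) : Matrix (Fin N) (Fin N) ℂ) * S₄ * star ((A * B₁ * B₂ * B₃⁻¹ * B₄⁻¹ : SU N) : Matrix (Fin N) (Fin N) ℂ)‖ ≤
      2 * (12 * α) * ((P.L : ℝ) * M) :=
    (norm_conj_sub_conj_le _ _ _).trans (mul_le_mul (mul_le_mul_of_nonneg_left hg₄ (by norm_num)) (hline _ _) (norm_nonneg _) (by positivity))
  calc _ ≤ ‖((V₁ * A₂ : SU N) : Matrix (Fin N) (Fin N) ℂ) * S₂ * star ((V₁ * A₂ : SU N) : Matrix (Fin N) (Fin N) ℂ) -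
            ((A * B₁ : SU N) : Matrix (Fin N) (Fin N) ℂ) * S₂ * star ((A * B₁ : SU N) : Matrix (Fin N) (Fin N) ℂ)‖ +
          ‖((V₁ * V₂ * V₃⁻¹ * A₃ : SU N) : Matrix (Fin N) (Fin N) ℂ) * S₃ * star ((V₁ * V₂ * V₃⁻¹ * A₃ : SU N) : Matrix (Fin N) (Fin N) ℂ) -
            ((A * B₁ * B₂ * B₃⁻¹ : SU N) : Matrix (Fin N) (Fin N) ℂ) * S₃ * star ((A * B₁ * B₂ * B₃⁻¹ : SU N) : Matrix (Fin N) (Fin N) ℂ)‖ +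
          ‖((V₁ * V₂ * V₃⁻¹ * V₄⁻¹ * A : SU N) : Matrix (Fin N) (Fin N) ℂ) * S₄ * star ((V₁ * V₂ * V₃⁻¹ * V₄⁻¹ * A : SU N) : Matrix (Fin N) (Fin N) ℂ) -
            ((A * B₁ * B₂ * B₃⁻¹ * B₄⁻¹ : SU N) : Matrix (Fin N) (Fin N) ℂ) * S₄ * star ((A * B₁ * B₂ * B₃⁻¹ * B₄⁻¹ : SU N) : Matrix (Fin N) (Fin N) ℂ)‖ :=
        (norm_sub_le _ _).trans (add_le_add (norm_sub_le _ _) le_rfl)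
    _ ≤ 2 * (3 * α) * ((P.L : ℝ) * M) + 2 * (9 * α) * ((P.L : ℝ) * M) + 2 * (12 * α) * ((P.L : ℝ) * M) := add_le_add (add_le_add h2 h3) h4
    _ = 48 * α * ((P.L : ℝ) * M) := by ring

end PerIndex

end Summit.QuantumFields.YangMills.Theorems.FluctuationComparisonRegPrIntLS2BetaCoarseCurlTransports

end
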